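import Summits.BirchSwinnertonDyer.BirchSwinnertonDyer.Theses.SmallImageMuTransfer
import Summits.BirchSwinnertonDyer.BirchSwinnertonDyer.Theses.PAdicOrderV2
import Summits.BirchSwinnertonDyer.BirchSwinnertonDyer.Theorems.SmallImageMuTransferSchneiderX9RankOneOfOrderOne
import Literature.NumberTheory.EllipticCurves.CanonicalPAdicHeight
import HarnessLib

/-!
# Route `SmallImageMuTransfer` (rung K6), crux `SchneiderX9RankOne` (stmt-BirchSwinnertonDyer-19631):
# the line `birth` is TIGHT, and its open stub is the X9-restriction of crux `PAdicOrderRankOneR4`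

Helper file (`--supports stmt-BirchSwinnertonDyer-19631 --as helper`; nothing here closes an item and no
summit statement is proved).  The registered line of the crux (skeleton `Cruxes/SchneiderX9RankOne/
Lines/birth.lean`, lead bsd-line-k6-p3) reads

  `SchneiderX9RankOne ⇐ stub_orderOne + stub_publishedInputsRankOne`,

where `stub_orderOne` = "`[T¹] L_p(f, α, T) ≠ 0` for every newform `f` of every rank-`1` X9 pair" (OPEN,
conjecture-grade) and `stub_publishedInputsRankOne` = Perrin-Riou 1987 Cor. 1.8 ∧ Gross–Zagier–Kolyvagin ∧
modularity (three conjuncts of the route's `PublishedInputsX9`).  This file records, kernel-checked: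

1. `orderOne_of_padicOrderRankOneR4` — `stub_orderOne` is IMPLIED (unconditionally) by the crux
   `Theses.PAdicOrderV2.PAdicOrderRankOneR4` (stmt-BirchSwinnertonDyer-0515: `ord_T L_p(E,T) = 1` for EVERY
   elliptic curve of analytic rank one at EVERY good ordinary prime), and on the X9 pairs the two
   formulations `[T¹] L_p ≠ 0` / `ord_T L_p = 1` are EQUIVALENT (`orderOne_iff_order_eq_one_classX9`;
   `L_p(0) = 0` in analytic rank one is a tree theorem).  So the open content of this crux is literally the
   X9-restriction of crux 0515, whose strategist census located the wall at rank-one Schneider for non-CM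
   curves (a `p`-adic transcendence input absent from print).
2. `schneiderX9RankOne_of_padicOrderRankOneR4` — hence crux 0515 ⟹ crux 19631 BY NAME, modulo the three
   published inputs.
3. `orderOne_of_schneiderX9RankOne` / `schneiderX9RankOne_iff_orderOne` — the converse: modulo
   Perrin-Riou + GZK and the EXISTENCE of the canonical height datum (`WeierstrassCurve.exists_isCanonical`,
   Stein–Wuthrich 2013 §4.1, a named fact), the crux implies `stub_orderOne`; so the line loses nothing —
   `stub_orderOne` is necessary and sufficient for the crux given the published inputs.

Sources: Perrin-Riou, Invent. Math. 89 (1987) §1.4 Cor. 1.8 (`[T¹]L_p · log_p γ = q (1 − α⁻¹)² Reg_p`,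
tree theorem `Wuthrich2014.coeff_one_padicLFunction_ne_zero_iff_schneider` modulo the facts);
Mazur–Tate–Teitelbaum 1986 §I.14 (interpolation, `L_p(0) = 0`); Schneider 1985 §1.
-/

-- the summit and its single problem are both named `BirchSwinnertonDyer` (registry layout D-0017)
set_option linter.dupNamespace false

set_option autoImplicit false

noncomputable section

open scoped Classical MatrixGroups ModularForm

open CongruenceSubgroup WeierstrassCurve
open Literature.NumberTheory.EllipticCurves Literature.NumberTheory.EllipticCurves.ModularForms
  Literature.NumberTheory.EllipticCurves.Wuthrich2014

namespace Summit.BirchSwinnertonDyer.BirchSwinnertonDyer.Rank1Residual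

/-- An X9 pair `(W, p)` is good ordinary at `p` (`IsOrdinaryAt W p`: good reduction and `p ∤ a_p` are
conjuncts 3 and 4 of `ClassX9`). [folklore] -/
theorem ClassX9.isOrdinaryAt {W : WeierstrassCurve ℚ} [W.IsElliptic] [W.IsGloballyMinimal] {p : ℕ}
    [Fact p.Prime] (h : ClassX9 W p) : IsOrdinaryAt W p :=
  ⟨h.2.2.1, h.2.2.2.1⟩

/-- **On a rank-one X9 pair the two formulations of the open stub agree**: for `f` a newform of `W`,
`[T¹] L_p(f, α, T) ≠ 0 ↔ ord_T L_p(f, α, T) = 1`, because `L_p(0) = (1 − α⁻¹)² L(E,1)/Ω⁺_f = 0` in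
analytic rank one (Mazur–Swinnerton-Dyer interpolation; tree theorem
`Wuthrich2014.constantCoeff_padicLFunction_eq_zero_of_analyticRank_eq_one`). Unconditional; same
content as `PAdicOrderRankOneR4.Negative.order_eq_one_iff_coeff_one_ne_zero` (crux 0515's support
file), re-derived here from the Literature layer so that this file does not build on that route's cone.
[cite: MazurTateTeitelbaum1986Invent, §I.14 (14.3)] -/
theorem orderOne_iff_order_eq_one_classX9 (W : WeierstrassCurve ℚ) [W.IsElliptic]
    [W.IsGloballyMinimal] (p : ℕ) [Fact p.Prime] (hX9 : ClassX9 W p) (han : W.analyticRank = 1)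
    {N : ℕ} [NeZero N] (f : CuspForm (Gamma0 N) 2) (hf : IsNewformOf W f) :
    PowerSeries.coeff 1 (padicLFunction f (unitRoot W p : ℚ_[p])) ≠ 0 ↔
      (padicLFunction f (unitRoot W p : ℚ_[p])).order = 1 := by
  have h0 := constantCoeff_padicLFunction_eq_zero_of_analyticRank_eq_one W p hX9.isOrdinaryAt han f hf
  rw [show (1 : ℕ∞) = ((1 : ℕ) : ℕ∞) from rfl, PowerSeries.order_eq_nat]
  constructor
  · intro h
    refine ⟨h, fun i hi ↦ ?_⟩
    obtain rfl : i = 0 := by omega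
    rwa [PowerSeries.coeff_zero_eq_constantCoeff_apply]
  · exact fun h ↦ h.1

/-- **Crux `PAdicOrderRankOneR4` (stmt-BirchSwinnertonDyer-0515) implies the open stub `stub_orderOne`
of this crux, unconditionally**: `ord_T L_p(E,T) = 1` at every good ordinary prime of every analytic
rank-one curve gives in particular `[T¹] L_p ≠ 0` on the rank-one X9 pairs (good ordinary `p ≥ 5` is
inside `ClassX9`). The conclusion is the registered signature of `stub_orderOne` verbatim.
[cite: MazurTateTeitelbaum1986Invent, §I.14 (14.3)] -/
theorem orderOne_of_padicOrderRankOneR4 (h0515 : Theses.PAdicOrderV2.PAdicOrderRankOneR4) :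
    ∀ (W : WeierstrassCurve ℚ) [W.IsElliptic] [W.IsGloballyMinimal] (p : ℕ) [Fact p.Prime]
      {N : ℕ} [NeZero N] (f : CuspForm (Gamma0 N) 2),
      ClassX9 W p → W.analyticRank = 1 → IsNewformOf W f →
        PowerSeries.coeff 1 (padicLFunction f (unitRoot W p : ℚ_[p])) ≠ 0 := by
  intro W _ _ p _ N _ f hX9 han hf
  exact (orderOne_iff_order_eq_one_classX9 W p hX9 han f hf).mpr
    (h0515 W p hX9.isOrdinaryAt han f hf)

/-- Conversely, `stub_orderOne` gives `ord_T L_p = 1` (crux 0515's formulation) on every rank-one X9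
pair, unconditionally. [cite: MazurTateTeitelbaum1986Invent, §I.14 (14.3)] -/
theorem order_eq_one_classX9_of_orderOne
    (h1 : ∀ (W : WeierstrassCurve ℚ) [W.IsElliptic] [W.IsGloballyMinimal] (p : ℕ) [Fact p.Prime]
      {N : ℕ} [NeZero N] (f : CuspForm (Gamma0 N) 2),
      ClassX9 W p → W.analyticRank = 1 → IsNewformOf W f →
        PowerSeries.coeff 1 (padicLFunction f (unitRoot W p : ℚ_[p])) ≠ 0)
    (W : WeierstrassCurve ℚ) [W.IsElliptic] [W.IsGloballyMinimal] (p : ℕ) [Fact p.Prime]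
    (hX9 : ClassX9 W p) (han : W.analyticRank = 1) {N : ℕ} [NeZero N] (f : CuspForm (Gamma0 N) 2)
    (hf : IsNewformOf W f) : (padicLFunction f (unitRoot W p : ℚ_[p])).order = 1 :=
  (orderOne_iff_order_eq_one_classX9 W p hX9 han f hf).mp (h1 W p f hX9 han hf)

/-- **Crux 0515 ⟹ crux 19631, by name, modulo the published inputs.** If `ord_T L_p(E,T) = 1` for every
analytic rank-one curve at every good ordinary prime (`Theses.PAdicOrderV2.PAdicOrderRankOneR4`), then —
granted Perrin-Riou 1987 Cor. 1.8 (`hPR`), Gross–Zagier–Kolyvagin (`hGZK`) and modularity (`hmodP`),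
all conjuncts of the route's `PublishedInputsX9` — Schneider's conjecture holds on the rank-one part of
X9 for every canonical height datum (`Theses.SmallImageMuTransfer.SchneiderX9RankOne`). Composition of
`orderOne_of_padicOrderRankOneR4` with the landed `schneiderX9RankOne_of_perrinRiou` (p415447).
CONDITIONAL on the three named facts and on crux 0515 (open). [cite: PerrinRiou1987, §1.4 Cor. 1.8] -/
theorem schneiderX9RankOne_of_padicOrderRankOneR4 (hPR : perrinRiou_rankOne_leadingTerms)
    (hGZK : rank_eq_analyticRank_of_analyticRank_le_one)
    (hmodP : nonempty_modularParametrizationData)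
    (h0515 : Theses.PAdicOrderV2.PAdicOrderRankOneR4) :
    Theses.SmallImageMuTransfer.SchneiderX9RankOne := by
  unfold Theses.SmallImageMuTransfer.SchneiderX9RankOne
  exact schneiderX9RankOne_of_perrinRiou hPR hGZK hmodP (orderOne_of_padicOrderRankOneR4 h0515)

/-- **The line is tight: the crux implies its open stub** (modulo Perrin-Riou 1987 Cor. 1.8 `hPR`,
Gross–Zagier–Kolyvagin `hGZK`, and the EXISTENCE of the canonical cyclotomic `p`-adic height datum at a
good ordinary `p ≥ 5`, `hcan : WeierstrassCurve.exists_isCanonical`, Stein–Wuthrich 2013 §4.1). Given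
Schneider on the rank-one X9 pairs for every canonical datum, pick THE canonical datum `Dh` of an X9 pair
(`hcan`; `p ≥ 5` good ordinary is inside `ClassX9`) and read Perrin-Riou's identity
`[T¹]L_p · log_p γ = q (1 − α⁻¹)² Reg_p(Dh)` (`q ≠ 0`) forwards
(`Wuthrich2014.coeff_one_padicLFunction_ne_zero_iff_schneider`, `.mpr`). The conclusion is the
registered signature of `stub_orderOne` verbatim. [cite: PerrinRiou1987, §1.4 Cor. 1.8]
[cite: SteinWuthrich2013, §4.1 eq. (4.1)] -/
theorem orderOne_of_schneiderX9RankOne (hPR : perrinRiou_rankOne_leadingTerms)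
    (hGZK : rank_eq_analyticRank_of_analyticRank_le_one)
    (hcan : WeierstrassCurve.exists_isCanonical)
    (h3 : Theses.SmallImageMuTransfer.SchneiderX9RankOne) :
    ∀ (W : WeierstrassCurve ℚ) [W.IsElliptic] [W.IsGloballyMinimal] (p : ℕ) [Fact p.Prime]
      {N : ℕ} [NeZero N] (f : CuspForm (Gamma0 N) 2),
      ClassX9 W p → W.analyticRank = 1 → IsNewformOf W f →
        PowerSeries.coeff 1 (padicLFunction f (unitRoot W p : ℚ_[p])) ≠ 0 := by
  unfold Theses.SmallImageMuTransfer.SchneiderX9RankOne at h3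
  intro W _ _ p _ N _ f hX9 han hf
  obtain ⟨Dh, hDh⟩ := hcan W p hX9.2.1 hX9.2.2.1 hX9.2.2.2.1
  exact (coeff_one_padicLFunction_ne_zero_iff_schneider hPR hGZK W p hX9.2.1 hX9.isOrdinaryAt han Dh
    hDh f hf).mpr (h3 W p hX9 han Dh hDh)

/-- **Crux `SchneiderX9RankOne` ⟺ its open stub `stub_orderOne`, modulo the published inputs**
(Perrin-Riou 1987 Cor. 1.8, Gross–Zagier–Kolyvagin, modularity, existence of the canonical height):
Schneider's non-degeneracy on the rank-one X9 pairs for every canonical datum holds iff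
`[T¹] L_p(f, α, T) ≠ 0` for every newform of every rank-one X9 pair. Bookkeeping for the line `birth`:
its one open stub is exactly as strong as the crux. [cite: PerrinRiou1987, §1.4 Cor. 1.8] -/
theorem schneiderX9RankOne_iff_orderOne (hPR : perrinRiou_rankOne_leadingTerms)
    (hGZK : rank_eq_analyticRank_of_analyticRank_le_one)
    (hmodP : nonempty_modularParametrizationData) (hcan : WeierstrassCurve.exists_isCanonical) :
    Theses.SmallImageMuTransfer.SchneiderX9RankOne ↔
      ∀ (W : WeierstrassCurve ℚ) [W.IsElliptic] [W.IsGloballyMinimal] (p : ℕ) [Fact p.Prime]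
        {N : ℕ} [NeZero N] (f : CuspForm (Gamma0 N) 2),
        ClassX9 W p → W.analyticRank = 1 → IsNewformOf W f →
          PowerSeries.coeff 1 (padicLFunction f (unitRoot W p : ℚ_[p])) ≠ 0 := by
  refine ⟨orderOne_of_schneiderX9RankOne hPR hGZK hcan, fun h1 ↦ ?_⟩
  unfold Theses.SmallImageMuTransfer.SchneiderX9RankOne
  exact schneiderX9RankOne_of_perrinRiou hPR hGZK hmodP h1

/-- **Crux `SchneiderX9RankOne` ⟺ the X9-restriction of crux `PAdicOrderRankOneR4`, modulo the same
published inputs**: Schneider on the rank-one X9 pairs (every canonical datum) iff `ord_T L_p(E,T) = 1`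
for every newform of every rank-one X9 pair. [cite: PerrinRiou1987, §1.4 Cor. 1.8] -/
theorem schneiderX9RankOne_iff_order_eq_one_classX9 (hPR : perrinRiou_rankOne_leadingTerms)
    (hGZK : rank_eq_analyticRank_of_analyticRank_le_one)
    (hmodP : nonempty_modularParametrizationData) (hcan : WeierstrassCurve.exists_isCanonical) :
    Theses.SmallImageMuTransfer.SchneiderX9RankOne ↔
      ∀ (W : WeierstrassCurve ℚ) [W.IsElliptic] [W.IsGloballyMinimal] (p : ℕ) [Fact p.Prime],
        ClassX9 W p → W.analyticRank = 1 →
        ∀ {N : ℕ} [NeZero N] (f : CuspForm (Gamma0 N) 2), IsNewformOf W f →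
          (padicLFunction f (unitRoot W p : ℚ_[p])).order = 1 := by
  rw [schneiderX9RankOne_iff_orderOne hPR hGZK hmodP hcan]
  constructor
  · intro h1 W _ _ p _ hX9 han N _ f hf
    exact order_eq_one_classX9_of_orderOne h1 W p hX9 han f hf
  · intro h W _ _ p _ N _ f hX9 han hf
    exact (orderOne_iff_order_eq_one_classX9 W p hX9 han f hf).mpr (h W p hX9 han f hf)

end Summit.BirchSwinnertonDyer.BirchSwinnertonDyer.Rank1Residual

end
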